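import Literature.AlgebraicGeometry.HodgeTheory.HodgeLocus
import Literature.AlgebraicGeometry.Motives.ComplexPointsManifold
import Literature.AlgebraicTopology.SingularHomology.PoincareDuality
import Literature.AlgebraicTopology.SingularHomology.CupProductProofs
import HarnessLib

/-!
# Vanishing cycles of a nodal (Lefschetz) degeneration

Family `hodge`, layer `Literature/AlgebraicGeometry/HodgeTheory`. Consumer: route
`IncidenceNodePeeling` of the Hodge conjecture (cruxes `ForcingCaseB`, `EndStateSupported`), which
needs to TYPE the conditions `⟨ζ, δ⟩ ≠ 0` and `ζ ↦ ζ − (⟨ζ, δ⟩ / ⟨δ, δ⟩) δ` for `δ` the vanishing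
cycle of a one-nodal degeneration of a smooth projective variety, on the tree's real carriers
(singular (co)homology of complex points, `cupPairing`, the tubes `tubeOver` / `fiberToTube` of
`HodgeTheory/HodgeLocus`).

## The mathematics (Voisin, *Hodge Theory and Complex Algebraic Geometry II*, §2.2, §3.2.1)

Let `f : 𝒳 → Δ` be a *Lefschetz degeneration*: `f` proper holomorphic onto a disk, submersive over
`Δ* = Δ ∖ {0}`, the central fibre `X₀` having one ordinary double point as its only singularity;
let `t ∈ Δ*` and let `m` be the dimension of the fibres. The smooth fibre `X_t` contains a
*vanishing sphere* `S_t^m` (inside a Milnor ball at the node), whose class `δ ∈ H_m(X_t, ℤ)`,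
defined by the choice of an orientation of the sphere, "is well-defined up to sign" [§2.2.1,
Def. 2.12]. `X_Δ = f⁻¹(Δ)` retracts onto `X_t` with an `(m+1)`-ball glued along `S_t^m`
[Thm. 2.16], whence [Cor. 2.17]: *`i_* : H_k(X_t, ℤ) → H_k(X_Δ, ℤ)` is an isomorphism for `k < m`,
surjective for `k = m`, and the kernel of `i_*` in degree `m` is generated by the class of 'the'
vanishing sphere.* The cohomological vanishing cycle is the Poincaré dual `δ ∈ H^m(X_t, ℤ)`: "It
is a generator of `Ker (H^m(X_t, ℤ) ≅ H_m(X_t, ℤ) → H_m(X, ℤ))`" [§3.2.1, before Thm. 3.16].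

THIS FILE DEFINES the vanishing cycle through exactly this printed characterisation, for an
algebraic family `f : 𝒳 ⟶ S` of `ℂ`-schemes, a subset `U ⊆ S(ℂ)` of the base (Voisin's disk `Δ`;
the tube `tubeOver f U = f(ℂ)⁻¹(U) ⊆ 𝒳(ℂ)` is Voisin's `X_Δ`) and a point `t ∈ U` (the fibre
`X_t = Motives.fiberOver f t`, included in the tube by `fiberToTube f ht`):

* `vanishingHomology R f ht k := Ker (i_* : H_k(X_t(ℂ); R) → H_k(f(ℂ)⁻¹U; R))`;
* `IsHomologicalVanishingCycle R f ht γ` — `γ ∈ H_k(X_t(ℂ); R)` generates `vanishingHomology`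
  (Cor. 2.17 as the defining property);
* `IsVanishingCycleOfNode R f ht μ δ` — the COHOMOLOGICAL vanishing cycle: `δ ∈ Hⁿ(X_t(ℂ); R)`
  whose Poincaré dual `δ ⌢ [X_t(ℂ)]_μ` (`poincareDualityMap μ`, `μ` an `R`-orientation of the
  closed `2n`-manifold `X_t(ℂ)`) generates `vanishingHomology R f ht n`; and the set
  `vanishingCycleOfNode R f ht μ` of all such `δ` ("the" vanishing cycle up to sign).

For `R = ℤ`, `U ≅ Δ` a disk over which `f(ℂ)` is a Lefschetz degeneration with critical value in
`U` and `t ∈ U` non-critical, `vanishingCycleOfNode ℤ f ht μ = {δ, -δ}` for the class `δ` of the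
vanishing sphere whenever that class has infinite order (always for `n` even: `⟨δ, δ⟩ = ±2`
[Rem. 3.21]); if the vanishing class is torsion of order `k` the set consists of its `φ(k)` unit
multiples, if it is `0` (a separating node of a curve) the set is `{0}` — all with image `0` in
rational cohomology. For `R` a field (`ℚ`, `ℂ`: the carrier `HodgeTheory.complexBetti` of the Hodge
conjecture files is `H^*(X(ℂ); ℂ)`) the predicate fixes `δ` up to a non-zero scalar, which is all
that `⟨ζ, δ⟩ ≠ 0` and `ζ − (⟨ζ, δ⟩ / ⟨δ, δ⟩) δ` depend on; `⟨a, b⟩ = ⟨a ⌣ b, [X_t(ℂ)]⟩` is the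
tree's `cupPairing μ`.

PROVED API: unfolding lemmas; `vanishingHomology_mono`; definedness up to sign / unit
(`IsVanishingCycleOfNode.neg`, `.smul`); `.poincareDual_mem`, `.exists_smul_eq`;
`isVanishingCycleOfNode_zero_iff`; independence of `μ ↦ -μ`
(`vanishingCycleOfNode_neg_orientation`);
and the (easy half of the) **local invariant cycle property**: a class of `X_t` that extends over
the tube `f⁻¹U` is ORTHOGONAL to the vanishing cycle, `⟨ξ|_{X_t}, δ⟩ = 0 = ⟨δ, ξ|_{X_t}⟩`
(`IsVanishingCycleOfNode.cupPairing_restrict_eq_zero`, `.cupPairing_restrict_eq_zero'`) — the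
inclusion `Im (Hⁿ(X_Δ) → Hⁿ(X_t)) ⊆ δ^⊥` behind "`⟨ζ, δ⟩ ≠ 0` forces `ζ` not to extend".

## Not here (deliberately)

* The node itself: "`X₀` has a single ordinary double point" is the separate notion
  `IsNodalHypersurface` (definition request `defn-IsNodalHypersurface`); the definitions below are
  stated for every `(f, U, t)` and are *meaningful* for Lefschetz degenerations (as
  `poincareDualityMap` is defined for every space and meaningful for closed manifolds).
* The Picard–Lefschetz formula `T(α) = α + ε ⟨α, δ⟩ δ`, `ε = -(-1)^{(m+1)m/2}` for `m` even
  [Thm. 3.16, Rem. 3.18], the self-intersection `⟨δ, δ⟩ = (-1)^{(m+1)m/2} · 2` for `m` even, `0` for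
  `m` odd [Rem. 3.21, Cor. 3.17], the equality `Im = δ^⊥` and the orthogonality of the vanishing
  cycles of distinct nodes of one fibre: they need the local monodromy operator, the complex
  orientation of `X_t(ℂ)`, Ehresmann's theorem and the ordinary-double-point condition, none of
  which is in the tree yet; they are to be vendored as named facts on top of this file. (For `m`
  even the Picard–Lefschetz transformation is Mathlib's `Module.reflection` for the coroot
  `-ε ⟨·, δ⟩`.)

## References

* [VoisinHodgeII2003] C. Voisin, Hodge Theory and Complex Algebraic Geometry II, CUP 2003, §2.2.1
  Def. 2.12, §2.2.2 Thm. 2.16, Cor. 2.17, §3.2.1 Thm. 3.16, Cor. 3.17, Rem. 3.18, Rem. 3.21.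
* [Milnor1968] J. Milnor, Singular Points of Complex Hypersurfaces (1968), Thm. 6.5, 7.2.
* [HatcherAT2002] A. Hatcher, Algebraic Topology, CUP 2002, §3.3 Thm. 3.30, Lemma 3.27.
-/

noncomputable section

open CategoryTheory AlgebraicGeometry
open Literature.AlgebraicTopology.SingularHomology

universe v

namespace Literature.AlgebraicGeometry.HodgeTheory

section HodgeTheory

variable {𝒳 S : Motives.SchemeOver ℂ}

/-! ### Tubes over nested subsets of the base -/

/-- The inclusion of tubes `f⁻¹U(ℂ) ↪ f⁻¹U'(ℂ)` for `U ⊆ U'` (`tubeOver f U ⊆ tubeOver f U'`), as a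
continuous map. [folklore] -/
def tubeOverInclusion (f : 𝒳 ⟶ S) {U U' : Set (Motives.ComplexPoints S)} (h : U ⊆ U') :
    C(tubeOver f U, tubeOver f U') :=
  ⟨fun P ↦ ⟨P.1, h P.2⟩, continuous_subtype_val.subtype_mk _⟩

/-- `X_t(ℂ) → f⁻¹U(ℂ) ↪ f⁻¹U'(ℂ)` is `X_t(ℂ) → f⁻¹U'(ℂ)`. [folklore] -/
theorem tubeOverInclusion_comp_fiberToTube (f : 𝒳 ⟶ S) {U U' : Set (Motives.ComplexPoints S)}
    (h : U ⊆ U') {t : Motives.ComplexPoints S} (ht : t ∈ U) :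
    (tubeOverInclusion f h).comp (fiberToTube f ht) = fiberToTube f (h ht) :=
  rfl

/-! ### The module of vanishing cycles -/

/-- The **vanishing homology** of the fibre `X_t` relative to the family over `U ∋ t`:
`V_k := Ker (i_* : H_k(X_t(ℂ); R) → H_k(f⁻¹U(ℂ); R))`, `i = fiberToTube f ht`, the classes of the
fibre that become null-homologous in the tube `X_U = f⁻¹(U)`. For a Lefschetz degeneration over a
disk `U` (one ordinary double point in the central fibre, `t ≠ 0`) and `k = dim X_t`, "the kernel
of `i_*` is generated by the class of 'the' vanishing sphere of `X_t`"; for `k < dim X_t` it is `0`.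
[cite: VoisinHodgeII2003, §2.2.2 Cor. 2.17] -/
def vanishingHomology (R : Type v) [CommRing R] (f : 𝒳 ⟶ S) {U : Set (Motives.ComplexPoints S)}
    {t : Motives.ComplexPoints S} (ht : t ∈ U) (k : ℕ) :
    Submodule R (singularHomology R R (Motives.ComplexPoints (Motives.fiberOver f t)) k) :=
  LinearMap.ker (singularHomology.map R R (fiberToTube f ht) k).hom

variable {R : Type v} [CommRing R] {f : 𝒳 ⟶ S} {U U' : Set (Motives.ComplexPoints S)}
  {t : Motives.ComplexPoints S}

/-- `γ` is a vanishing class iff `i_* γ = 0` in `H_k(f⁻¹U(ℂ); R)`.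
[cite: VoisinHodgeII2003, §2.2.2 Cor. 2.17] -/
theorem mem_vanishingHomology_iff (ht : t ∈ U) {k : ℕ}
    (γ : singularHomology R R (Motives.ComplexPoints (Motives.fiberOver f t)) k) :
    γ ∈ vanishingHomology R f ht k ↔ singularHomology.map R R (fiberToTube f ht) k γ = 0 :=
  Iff.rfl

/-- Enlarging the neighbourhood of the base enlarges the vanishing module: a cycle of `X_t` that
bounds in `f⁻¹U` bounds in `f⁻¹U' ⊇ f⁻¹U` (functoriality of `H_k`). [folklore] -/
theorem vanishingHomology_mono (R : Type v) [CommRing R] (f : 𝒳 ⟶ S) (h : U ⊆ U') (ht : t ∈ U)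
    (k : ℕ) : vanishingHomology R f ht k ≤ vanishingHomology R f (h ht) k := by
  intro γ hγ
  rw [mem_vanishingHomology_iff] at hγ ⊢
  rw [← tubeOverInclusion_comp_fiberToTube f h ht, singularHomology.map_comp,
    ModuleCat.comp_apply, hγ, map_zero]

/-- **Classes extending over the tube are orthogonal to the vanishing homology**: for
`ξ ∈ Hᵏ(f⁻¹U(ℂ); R)` and a vanishing class `γ`, `⟨ξ|_{X_t}, γ⟩ = ⟨ξ, i_* γ⟩ = 0` (naturality of
the Kronecker pairing) — the inclusion `Im (Hᵏ(X_Δ) → Hᵏ(X_t)) ⊆ (Ker i_*)^⊥` of the local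
invariant cycle property. [cite: VoisinHodgeII2003, §2.2.2 Cor. 2.17] -/
theorem kroneckerPairing_map_fiberToTube_eq_zero (ht : t ∈ U) {k : ℕ}
    (ξ : singularCohomology R R (tubeOver f U) k)
    {γ : singularHomology R R (Motives.ComplexPoints (Motives.fiberOver f t)) k}
    (hγ : γ ∈ vanishingHomology R f ht k) :
    kroneckerPairing R R _ k (singularCohomology.map R R (fiberToTube f ht) k ξ) γ = 0 := by
  rw [kroneckerPairing_map, (mem_vanishingHomology_iff ht γ).1 hγ, map_zero]

/-! ### Vanishing cycles -/

/-- A **homological vanishing cycle** of the family `f` over `U` at `t`: a class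
`γ ∈ H_k(X_t(ℂ); R)` that GENERATES the vanishing homology, `R ∙ γ = Ker i_*`. For a Lefschetz
degeneration over a disk `U` and `k = dim X_t` this is (up to sign, over `ℤ`) the class of the
vanishing sphere, "the vanishing cycle of the Lefschetz degeneration" (Def. 2.12), by Cor. 2.17.
[cite: VoisinHodgeII2003, §2.2.1 Def. 2.12 and §2.2.2 Cor. 2.17] -/
def IsHomologicalVanishingCycle (R : Type v) [CommRing R] (f : 𝒳 ⟶ S)
    {U : Set (Motives.ComplexPoints S)} {t : Motives.ComplexPoints S} (ht : t ∈ U) {k : ℕ}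
    (γ : singularHomology R R (Motives.ComplexPoints (Motives.fiberOver f t)) k) : Prop :=
  Submodule.span R {γ} = vanishingHomology R f ht k

/-- A **(cohomological) vanishing cycle of a nodal degeneration**: for an `R`-orientation `μ` of
the `2n`-manifold `X_t(ℂ)` (`n = dim X_t`; intended: the complex orientation of the smooth
projective fibre), a class `δ ∈ Hⁿ(X_t(ℂ); R)` whose Poincaré dual `δ ⌢ [X_t(ℂ)]_μ ∈ H_n(X_t(ℂ); R)`
generates the vanishing homology of `f` over `U` at `t` — "It is a generator of
`Ker (Hⁿ(X_t, ℤ) ≅ H_n(X_t, ℤ) → H_n(X, ℤ))`", `X = f⁻¹(Δ)` the total space of the Lefschetz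
degeneration. Over `ℤ` this determines `δ` up to sign (when the vanishing class has infinite order,
e.g. `n` even); over a field, up to a non-zero scalar.
[cite: VoisinHodgeII2003, §3.2.1 Thm. 3.16 and the paragraph preceding it] -/
def IsVanishingCycleOfNode (R : Type v) [CommRing R] (f : 𝒳 ⟶ S)
    {U : Set (Motives.ComplexPoints S)} {t : Motives.ComplexPoints S} (ht : t ∈ U) {n : ℕ}
    (μ : HomologicalOrientation R (Motives.ComplexPoints (Motives.fiberOver f t)) (2 * n))
    (δ : singularCohomology R R (Motives.ComplexPoints (Motives.fiberOver f t)) n) : Prop :=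
  IsHomologicalVanishingCycle R f ht (poincareDualityMap μ (two_mul n).symm δ)

/-- **The vanishing cycle of a nodal degeneration, as the set of its determinations**: all
`δ ∈ Hⁿ(X_t(ℂ); R)` whose Poincaré dual generates the vanishing homology of `f` over `U` at `t`.
For a Lefschetz degeneration over a disk `U` and `R = ℤ` this is `{δ, -δ}` for the class `δ` of the
vanishing sphere ("well-defined up to sign"), provided that class has infinite order.
[cite: VoisinHodgeII2003, §2.2.1 Def. 2.12 and §3.2.1] -/
def vanishingCycleOfNode (R : Type v) [CommRing R] (f : 𝒳 ⟶ S)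
    {U : Set (Motives.ComplexPoints S)} {t : Motives.ComplexPoints S} (ht : t ∈ U) {n : ℕ}
    (μ : HomologicalOrientation R (Motives.ComplexPoints (Motives.fiberOver f t)) (2 * n)) :
    Set (singularCohomology R R (Motives.ComplexPoints (Motives.fiberOver f t)) n) :=
  {δ | IsVanishingCycleOfNode R f ht μ δ}

/-! ### API: unfolding -/

/-- Unfolding `IsHomologicalVanishingCycle`. [cite: VoisinHodgeII2003, §2.2.2 Cor. 2.17] -/
theorem isHomologicalVanishingCycle_iff (ht : t ∈ U) {k : ℕ}
    (γ : singularHomology R R (Motives.ComplexPoints (Motives.fiberOver f t)) k) :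
    IsHomologicalVanishingCycle R f ht γ ↔ Submodule.span R {γ} = vanishingHomology R f ht k :=
  Iff.rfl

/-- Unfolding `IsVanishingCycleOfNode`: `R ∙ (δ ⌢ [X_t(ℂ)]) = Ker i_*`.
[cite: VoisinHodgeII2003, §3.2.1] -/
theorem isVanishingCycleOfNode_iff (ht : t ∈ U) {n : ℕ}
    (μ : HomologicalOrientation R (Motives.ComplexPoints (Motives.fiberOver f t)) (2 * n))
    (δ : singularCohomology R R (Motives.ComplexPoints (Motives.fiberOver f t)) n) :
    IsVanishingCycleOfNode R f ht μ δ ↔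
      Submodule.span R {capProduct (two_mul n).symm δ μ.fundamentalClass} =
        vanishingHomology R f ht n :=
  Iff.rfl

/-- Membership in `vanishingCycleOfNode`. [cite: VoisinHodgeII2003, §3.2.1] -/
@[simp]
theorem mem_vanishingCycleOfNode_iff (ht : t ∈ U) {n : ℕ}
    (μ : HomologicalOrientation R (Motives.ComplexPoints (Motives.fiberOver f t)) (2 * n))
    (δ : singularCohomology R R (Motives.ComplexPoints (Motives.fiberOver f t)) n) :
    δ ∈ vanishingCycleOfNode R f ht μ ↔ IsVanishingCycleOfNode R f ht μ δ :=
  Iff.rfl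

/-! ### API: homological vanishing cycles -/

namespace IsHomologicalVanishingCycle

variable {ht : t ∈ U} {k : ℕ}
  {γ : singularHomology R R (Motives.ComplexPoints (Motives.fiberOver f t)) k}

/-- A vanishing cycle vanishes: `γ ∈ Ker i_*`. [cite: VoisinHodgeII2003, §2.2.2 Cor. 2.17] -/
theorem mem (hγ : IsHomologicalVanishingCycle R f ht γ) : γ ∈ vanishingHomology R f ht k := by
  rw [← hγ]
  exact Submodule.mem_span_singleton_self γ

/-- Every vanishing class is a multiple of the vanishing cycle.
[cite: VoisinHodgeII2003, §2.2.2 Cor. 2.17] -/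
theorem exists_smul_eq (hγ : IsHomologicalVanishingCycle R f ht γ)
    {x : singularHomology R R (Motives.ComplexPoints (Motives.fiberOver f t)) k}
    (hx : x ∈ vanishingHomology R f ht k) : ∃ a : R, a • γ = x := by
  rw [← hγ] at hx
  exact Submodule.mem_span_singleton.1 hx

/-- The vanishing cycle is defined up to sign: `-γ` is one if `γ` is.
[cite: VoisinHodgeII2003, §2.2.1 Def. 2.12] -/
theorem neg (hγ : IsHomologicalVanishingCycle R f ht γ) :
    IsHomologicalVanishingCycle R f ht (-γ) := by
  rw [isHomologicalVanishingCycle_iff, ← hγ, ← Set.neg_singleton, Submodule.span_neg]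

/-- More generally, unit multiples of a vanishing cycle are vanishing cycles. [folklore] -/
theorem smul (hγ : IsHomologicalVanishingCycle R f ht γ) {u : R} (hu : IsUnit u) :
    IsHomologicalVanishingCycle R f ht (u • γ) := by
  rw [isHomologicalVanishingCycle_iff, Submodule.span_singleton_smul_eq hu, hγ]

/-- Classes extending over the tube pair to zero with the vanishing cycle: `⟨ξ|_{X_t}, γ⟩ = 0`.
[cite: VoisinHodgeII2003, §2.2.2 Cor. 2.17] -/
theorem kroneckerPairing_eq_zero (hγ : IsHomologicalVanishingCycle R f ht γ)
    (ξ : singularCohomology R R (tubeOver f U) k) :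
    kroneckerPairing R R _ k (singularCohomology.map R R (fiberToTube f ht) k ξ) γ = 0 :=
  kroneckerPairing_map_fiberToTube_eq_zero ht ξ hγ.mem

end IsHomologicalVanishingCycle

/-- `-γ` is a homological vanishing cycle iff `γ` is. [cite: VoisinHodgeII2003, §2.2.1 Def. 2.12] -/
theorem isHomologicalVanishingCycle_neg_iff (ht : t ∈ U) {k : ℕ}
    (γ : singularHomology R R (Motives.ComplexPoints (Motives.fiberOver f t)) k) :
    IsHomologicalVanishingCycle R f ht (-γ) ↔ IsHomologicalVanishingCycle R f ht γ :=
  ⟨fun h ↦ by simpa using h.neg, fun h ↦ h.neg⟩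

/-- `0` is a homological vanishing cycle iff NOTHING vanishes (`Ker i_* = 0`; e.g. no critical value
in `U`, or a homologically trivial vanishing sphere). [folklore] -/
theorem isHomologicalVanishingCycle_zero_iff (ht : t ∈ U) (k : ℕ) :
    IsHomologicalVanishingCycle R f ht
        (0 : singularHomology R R (Motives.ComplexPoints (Motives.fiberOver f t)) k) ↔
      vanishingHomology R f ht k = ⊥ := by
  rw [isHomologicalVanishingCycle_iff, Submodule.span_singleton_eq_bot.2 rfl, eq_comm]

/-! ### API: cohomological vanishing cycles -/

namespace IsVanishingCycleOfNode

variable {ht : t ∈ U} {n : ℕ}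
  {μ : HomologicalOrientation R (Motives.ComplexPoints (Motives.fiberOver f t)) (2 * n)}
  {δ : singularCohomology R R (Motives.ComplexPoints (Motives.fiberOver f t)) n}

/-- The Poincaré dual `δ ⌢ [X_t(ℂ)]` of a vanishing cycle lies in the vanishing homology:
`i_* (δ ⌢ [X_t(ℂ)]) = 0`. [cite: VoisinHodgeII2003, §3.2.1] -/
theorem poincareDual_mem (hδ : IsVanishingCycleOfNode R f ht μ δ) :
    poincareDualityMap μ (two_mul n).symm δ ∈ vanishingHomology R f ht n :=
  (id hδ : IsHomologicalVanishingCycle R f ht _).mem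

/-- Every vanishing homology class is a multiple of `δ ⌢ [X_t(ℂ)]`.
[cite: VoisinHodgeII2003, §2.2.2 Cor. 2.17] -/
theorem exists_smul_eq (hδ : IsVanishingCycleOfNode R f ht μ δ)
    {x : singularHomology R R (Motives.ComplexPoints (Motives.fiberOver f t)) n}
    (hx : x ∈ vanishingHomology R f ht n) :
    ∃ a : R, a • poincareDualityMap μ (two_mul n).symm δ = x :=
  (id hδ : IsHomologicalVanishingCycle R f ht _).exists_smul_eq hx

/-- **Defined up to sign**: `-δ` is a vanishing cycle if `δ` is.
[cite: VoisinHodgeII2003, §2.2.1 Def. 2.12] -/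
theorem neg (hδ : IsVanishingCycleOfNode R f ht μ δ) : IsVanishingCycleOfNode R f ht μ (-δ) := by
  change IsHomologicalVanishingCycle R f ht (poincareDualityMap μ (two_mul n).symm (-δ))
  rw [map_neg]
  exact (id hδ : IsHomologicalVanishingCycle R f ht _).neg

/-- Unit multiples of a vanishing cycle are vanishing cycles (over a field: non-zero multiples).
[folklore] -/
theorem smul (hδ : IsVanishingCycleOfNode R f ht μ δ) {u : R} (hu : IsUnit u) :
    IsVanishingCycleOfNode R f ht μ (u • δ) := by
  change IsHomologicalVanishingCycle R f ht (poincareDualityMap μ (two_mul n).symm (u • δ))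
  rw [map_smul]
  exact (id hδ : IsHomologicalVanishingCycle R f ht _).smul hu

/-- **Tube classes are orthogonal to the vanishing cycle** (cohomological form): for
`ξ ∈ Hⁿ(f⁻¹U(ℂ); R)`,
`⟨δ ⌣ ξ|_{X_t}, [X_t(ℂ)]⟩ = ⟨ξ|_{X_t}, δ ⌢ [X_t(ℂ)]⟩ = ⟨ξ, i_*(δ ⌢ [X_t(ℂ)])⟩ = 0`
(`cupPairing_eq_kroneckerPairing_poincareDualityMap` and naturality of the Kronecker pairing). This
is the inclusion `Im (Hⁿ(X_Δ) → Hⁿ(X_t)) ⊆ δ^⊥` of the local invariant cycle property: a class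
`ζ` with `⟨ζ, δ⟩ ≠ 0` does not extend over the disk.
[cite: VoisinHodgeII2003, §2.2.2 Cor. 2.17 and §3.2.1 Thm. 3.16] -/
theorem cupPairing_restrict_eq_zero (hδ : IsVanishingCycleOfNode R f ht μ δ)
    (ξ : singularCohomology R R (tubeOver f U) n) :
    cupPairing μ (two_mul n).symm δ (singularCohomology.map R R (fiberToTube f ht) n ξ) = 0 := by
  rw [cupPairing_eq_kroneckerPairing_poincareDualityMap]
  exact (id hδ : IsHomologicalVanishingCycle R f ht _).kroneckerPairing_eq_zero ξ

/-- The same orthogonality with the arguments of the pairing exchanged,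
`⟨ξ|_{X_t} ⌣ δ, [X_t(ℂ)]⟩ = 0` (graded commutativity of `⌣`, the tree's proved
`cupProduct_gradedComm_holds`). [cite: VoisinHodgeII2003, §2.2.2 Cor. 2.17 and §3.2.1 Thm. 3.16] -/
theorem cupPairing_restrict_eq_zero' (hδ : IsVanishingCycleOfNode R f ht μ δ)
    (ξ : singularCohomology R R (tubeOver f U) n) :
    cupPairing μ (two_mul n).symm (singularCohomology.map R R (fiberToTube f ht) n ξ) δ = 0 := by
  have h := congrArg (fun B ↦ B (singularCohomology.map R R (fiberToTube f ht) n ξ) δ)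
    (cupPairing_flip (cupProduct_gradedComm_holds R _) μ (two_mul n).symm (two_mul n).symm)
  simp only [LinearMap.flip_apply, LinearMap.smul_apply] at h
  rw [hδ.cupPairing_restrict_eq_zero ξ, eq_comm,
    ((isUnit_one (M := R)).neg.pow _).smul_eq_zero] at h
  exact h

end IsVanishingCycleOfNode

/-- `-δ` is a vanishing cycle iff `δ` is. [cite: VoisinHodgeII2003, §2.2.1 Def. 2.12] -/
theorem isVanishingCycleOfNode_neg_iff (ht : t ∈ U) {n : ℕ}
    (μ : HomologicalOrientation R (Motives.ComplexPoints (Motives.fiberOver f t)) (2 * n))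
    (δ : singularCohomology R R (Motives.ComplexPoints (Motives.fiberOver f t)) n) :
    IsVanishingCycleOfNode R f ht μ (-δ) ↔ IsVanishingCycleOfNode R f ht μ δ :=
  ⟨fun h ↦ by simpa using h.neg, fun h ↦ h.neg⟩

/-- The set `vanishingCycleOfNode` is symmetric under `δ ↦ -δ`.
[cite: VoisinHodgeII2003, §2.2.1 Def. 2.12] -/
theorem neg_mem_vanishingCycleOfNode_iff (ht : t ∈ U) {n : ℕ}
    (μ : HomologicalOrientation R (Motives.ComplexPoints (Motives.fiberOver f t)) (2 * n))
    (δ : singularCohomology R R (Motives.ComplexPoints (Motives.fiberOver f t)) n) :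
    -δ ∈ vanishingCycleOfNode R f ht μ ↔ δ ∈ vanishingCycleOfNode R f ht μ :=
  isVanishingCycleOfNode_neg_iff ht μ δ

/-- `0` is a vanishing cycle iff the vanishing homology in the middle degree is `0` (no cycle of
`X_t` bounds in `f⁻¹U`: the non-degenerate situation). [folklore] -/
theorem isVanishingCycleOfNode_zero_iff (ht : t ∈ U) {n : ℕ}
    (μ : HomologicalOrientation R (Motives.ComplexPoints (Motives.fiberOver f t)) (2 * n)) :
    IsVanishingCycleOfNode R f ht μ 0 ↔ vanishingHomology R f ht n = ⊥ := by
  change IsHomologicalVanishingCycle R f ht (poincareDualityMap μ (two_mul n).symm 0) ↔ _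
  rw [map_zero, isHomologicalVanishingCycle_zero_iff]

/-! ### API: independence of the orientation -/

/-- **Reversing the orientation of `X_t(ℂ)` does not change the vanishing cycles**: for `X_t`
smooth projective of dimension `n` (so that `X_t(ℂ)` is a closed `2n`-manifold and
`[X_t(ℂ)]_{-μ} = -[X_t(ℂ)]_μ`, the tree's proved
`HomologicalOrientation.fundamentalClass_neg_holds`),
`δ ⌢ [X_t(ℂ)]_{-μ} = -(δ ⌢ [X_t(ℂ)]_μ)` generates the same submodule. Hence over `ℤ` the set
`vanishingCycleOfNode ℤ f ht μ` does not depend on the choice of `ℤ`-orientation of a connected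
`X_t(ℂ)`. [cite: HatcherAT2002, §3.3 Lemma 3.27] -/
theorem isVanishingCycleOfNode_neg_orientation_iff {n : ℕ}
    (hX : Motives.IsSmoothProjective n (Motives.fiberOver f t)) (ht : t ∈ U)
    (μ : HomologicalOrientation R (Motives.ComplexPoints (Motives.fiberOver f t)) (2 * n))
    (δ : singularCohomology R R (Motives.ComplexPoints (Motives.fiberOver f t)) n) :
    IsVanishingCycleOfNode R f ht (-μ) δ ↔ IsVanishingCycleOfNode R f ht μ δ := by
  letI := hX.chartedSpace
  haveI := Motives.ComplexPoints.compactSpace_of_isSmoothProjective hX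
  haveI := Motives.ComplexPoints.t2Space_of_isSmoothProjective hX
  have hneg : (-μ).fundamentalClass = -μ.fundamentalClass :=
    HomologicalOrientation.fundamentalClass_neg_holds R
      (Motives.ComplexPoints (Motives.fiberOver f t)) (2 * n) μ
  change IsHomologicalVanishingCycle R f ht (poincareDualityMap (-μ) (two_mul n).symm δ) ↔
    IsHomologicalVanishingCycle R f ht (poincareDualityMap μ (two_mul n).symm δ)
  rw [poincareDualityMap_apply, hneg, map_neg, ← poincareDualityMap_apply,
    isHomologicalVanishingCycle_neg_iff]

/-- The set of vanishing cycles is the same for `μ` and `-μ` (`X_t` smooth projective of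
dimension `n`). [cite: HatcherAT2002, §3.3 Lemma 3.27] -/
theorem vanishingCycleOfNode_neg_orientation {n : ℕ}
    (hX : Motives.IsSmoothProjective n (Motives.fiberOver f t)) (ht : t ∈ U)
    (μ : HomologicalOrientation R (Motives.ComplexPoints (Motives.fiberOver f t)) (2 * n)) :
    vanishingCycleOfNode R f ht (-μ) = vanishingCycleOfNode R f ht μ :=
  Set.ext fun δ ↦ isVanishingCycleOfNode_neg_orientation_iff hX ht μ δ

end HodgeTheory

end Literature.AlgebraicGeometry.HodgeTheory

end
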